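import Literature.IUT.HodgeArakelov.MonoThetaProjectiveProp16EllipticRefGenuine
import Literature.IUT.HodgeArakelov.MonoThetaProjectiveProp16CoreRef
import Literature.AnabelianGeometry.AbsoluteAnabelian.AbsTopII.EllipticCuspidalizationTF
import HarnessLib

/-!
# [IUTchII] Prop. 1.6 (i)/(ii): the reference clauses (R2)/(core) RE-POINTED to the print-faithful
# [AbsTopII] Cor. 3.3 record `AbsTopII.EllipticCuspidalizationTF` (finding T1g11-F1 at layer L6; successors + bridges)

Statement-only SUCCESSOR file (`Prop`-valued structures, bundled GENUINE structures, `toTF` bridges; NO edit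
of any landed module, NO new named fact, NO instance, NO notation) of the abc-iut cell, seat abc-iut-L6-t7 (gen 8),
for the DAG nodes **IUTchII:Prop1.6(i)** and **IUTchII:Prop1.6(ii)** (layer L6, OUTSIDE the [IUTchIII] Cor. 3.12
cone); abc-iut-L6-lead «L6 ROWS #6» slice (a) (§F v1.19eh (A), ruling M3); MERGE-MAP §8S row B18; impact census
`HOME/staging/L6/L6-t7/gen8/T1G11-F1-L6-IMPACT.md`.  The (R2′) CHAIN variants (`RefIsEllipticChainTF`,
`GenuineChainTF`) are NOT in this file: they wait on the L4 statement `AbsTopII.EllipticCuspidalizationTF.RealizesChain`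
(slice (c)); the proof-only ports of the `RefIsElliptic`/`RefIsCore` API over the TF predicates are slice (d1).

S. Mochizuki, *Inter-universal Teichmüller Theory II*, kurims manuscript (Dec. 2020), §1, Prop. 1.6 p. 31: (i)
l. 16–33 "(Cores) … there exists a functorial group-theoretic algorithm `Π ↦ {Π ⊆ Π_C(Π)}` … such that when
`Π = Π^tp_{X̲̲_k}`, the inclusion `Π ⊆ Π_C(Π)` may be naturally identified with the inclusion `Π^tp_{X̲̲_k} ⊆ Π^tp_{C_k}`";
(ii) l. 34–41 "(Elliptic Cuspidalizations) Let `N` be a positive integer. Then there exists a functorial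
group-theoretic algorithm [cf. [AbsTopII], Corollary 3.3, (iii); [AbsTopII], Remark 3.3.3] `Π ↦ {Π_{U_N}(Π) ↠ Π}` …
such that when `Π = Π^tp_{X̲̲_k}`, the surjection `Π_{U_N}(Π) ↠ Π` may be naturally identified with a certain
surjection — i.e., “elliptic cuspidalization” — that arises from a certain open immersion determined by the
`N`-torsion points of a once-punctured elliptic curve that forms a double covering of `C_k` [cf. [AbsTopII],
Corollary 3.3, (iii)]." [claim: Mochizuki2012, status: disputed] (IUTchII §1 Prop 1.6, kurims p.31).
S. Mochizuki, *Topics in Absolute Anabelian Geometry II*, Cor. 3.3 pp. 67–69; (ii) p. 68: "open subgroups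
`J ⊆ Π_C` of index `2` such that `J ∩ Δ_C` is torsion-free [i.e., the covering determined by `J` is a scheme]"
[cite: MochizukiAbsTopII2013, Cor 3.3 pp.67-69].

## Why (finding T1g11-F1 at L6)

The landed successor predicates `EllipticCuspidalization.RefIsElliptic` (abc-iut-w5-d030, clause (R2)),
`EllipticCuspidalization.RefIsEllipticChain` (abc-iut-L6-t2, clause (R2′)) and `CoreData.RefIsCore` (abc-iut-w5-d030,
clause (R2)) — and with them the GENUINE output structures `EllipticCuspidalization.Genuine` / `GenuineChain` /
`CoreData.Genuine` — quantify `∃ C : AbsTopII.EllipticCuspidalization E` over abc-iut-L4-t6's FROZEN output record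
of [AbsTopII] Cor. 3.3, whose clause (ii) is typed `IsMulTorsionFree ↥(Π_D ⊓ Δ_C)` (UNIQUE ROOTS).  That record is
UNINHABITED over every extension whose `Δ` is free pro-`Σ` of rank `≥ 2` with two primes in `Σ` — hence at every
genuine `Π^tp_{X̲̲_k}` (an affine hyperbolic curve: `Δ̂` free profinite of rank `≥ 2`) — so the three predicates are
FALSE and the three GENUINE structures EMPTY there (`Summit.ABC.IUTFork.refIsElliptic_false_of_isFreeProOn_deltaHat`,
`isEmpty_genuine_…`, `isEmpty_genuineChain_…`, `refIsCore_false_…`, `isEmpty_coreDataGenuine_…`, abc-iut-L4-t17).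
The print-faithful record is abc-iut-L4-t4's `AbsTopII.EllipticCuspidalizationTF E` (the same fields verbatim except
(ii) := `∀ g : ↥(Π_D ⊓ Δ_C), IsOfFinOrder g → g = 1`, bridge `EllipticCuspidalization.toTF`); it IS inhabited at
genuine free data by the degenerate identity record (abc-iut-L6-d7, slice (b)), so this re-point restores
SATISFIABILITY of the v1 predicates, not CONTENT — the content gate remains the chain conjunct of v2 (slice (c)).

## What is typed (append-only; every (R0)/(R1) field VERBATIM, only the record type of (R2)/(core) changes)

* `EllipticCuspidalization.RefIsEllipticTF K X U eX eU` — (R0) `deltaTemp_eq`, (R1) `K_eq`, `continuous_projRef`,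
  `aug_comp`, `kernel_eq` VERBATIM; (R2-TF) `elliptic : ∃ E iX (C : AbsTopII.EllipticCuspidalizationTF E) iU, …`;
* `EllipticCuspidalization.GenuineTF S N P X U eX` — the FROZEN output `EllipticCuspidalization S N P` extended by `eU`
  and the TF predicate, decl-for-decl as `Genuine`;
* `CoreData.RefIsCoreTF Cd X C eX eC` ((R0)(R1) VERBATIM; (R2-core-TF) `core : ∃ E iX (R : AbsTopII.EllipticCuspidalizationTF E) iC, …`)
  and `CoreData.GenuineTF S P X C eX`;
* bridges `RefIsElliptic.toTF`, `Genuine.toTF`, `RefIsCore.toTF`, `CoreData.Genuine.toTF` (via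
  `AbsTopII.EllipticCuspidalization.toTF`, whose projections are `rfl`), so every landed inhabitant / theorem over the
  frozen currency transfers; `RefIsEllipticTF.exists_level`, `RefIsCoreTF.exists_core_record` (the re-export
  theorems in the TF currency); and `GenuineTF.transport` (functoriality, as `Genuine.transport`).

HONEST SCOPE: predicates/structures over interface data; nothing is asserted to be inhabited; inhabiting them at the
[EtTh] model still needs the [SemiAnbd] §6 interface data of `U_X` / `C_k` (MERGE-MAP rows 92/141/91, unchanged) and
a CONSTRUCTED print-faithful Cor. 3.3 record at `Π̂_X` (abc-iut-L4's `Cor_3_3_iiiTF` suppliers); the frozen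
predicates and structures are untouched and keep their (vacuous-at-genuine-`X`) theorems.  Nothing here takes a side
on [IUTchIII] Cor. 3.12; typed ≠ proved; re-typed ≠ constructed; nothing here asserts abc proved or refuted.
-/

open Topology
open scoped Pointwise

universe u

namespace Literature.IUT.HodgeArakelov

open Literature.AnabelianGeometry.SemiGraphs (TemperedCurve)
open Literature.AnabelianGeometry.AbsoluteAnabelian (FundamentalExtension)

/-! ## Prop. 1.6 (ii): the elliptic-cuspidalisation reference clause over the TF record -/

namespace EllipticCuspidalization

section Ref

variable {S : ThetaSetting.{u}} {N : ℕ+} {P : TopGroup.{u}} {p : ℕ} [Fact p.Prime]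
  (K : EllipticCuspidalization S N P) (X U : TemperedCurve p)
  (eX : X.PiTemp ≃ₜ* S.PiX) (eU : U.PiTemp ≃ₜ* K.PiURef)

/-- **THE SUCCESSOR PREDICATE of IUTchII:Prop1.6(ii) in the print-faithful currency (finding T1g11-F1).**
abc-iut-w5-d030's `RefIsElliptic` with (R0) "`Π = Π^tp_{X̲̲_k}`" and (R1) (tempered cuspidalisation over the
augmentations, `DLoc` kernel, removed cusps over NON-cuspidal points — [AbsTopII] Cor. 3.3 (iii)(c), Rmk. 3.3.3)
VERBATIM, and (R2-TF): the profinite completion of `Π^tp_U ↠ Π^tp_X` IS a [AbsTopII] Cor. 3.3 (iii) output record OF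
LEVEL `N` in abc-iut-L4-t4's PRINT-FAITHFUL type `AbsTopII.EllipticCuspidalizationTF` ((ii) = "`Π_D ∩ Δ_C` has no
non-trivial element of finite order") over an extension `E ≅ Π̂_X` matching `Δ̂_X`.  A `Prop`; never asserted; to be
inhabited at genuine models and consumed BY NAME. [cite: MochizukiAbsTopII2013, Rmk 3.3.3 p.69]
[claim: Mochizuki2012, status: disputed] (IUTchII §1 Prop 1.6 (ii), kurims p.31) -/
structure RefIsEllipticTF : Prop where
  /-- (R0) "`Π = Π^tp_{X̲̲_k}`": `eX` carries `Δ^tp_X` onto the setting's `Δ^tp_{X̲̲_k} = Ker(S.aug)` -/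
  deltaTemp_eq : X.DeltaTemp.map eX.toMulEquiv.toMonoidHom = S.DeltaX
  /-- `U_X` and `X̲̲_k` are curves over the same field `k` -/
  K_eq : U.K = X.K
  /-- the reference surjection is continuous -/
  continuous_projRef : Continuous K.projRef
  /-- … and lies over the augmentations to `G_k ≤ G_{ℚ_p}` -/
  aug_comp : ∀ y : U.PiTemp, X.aug (K.refHom X U eX eU y) = U.aug y
  /-- (R1) + [AbsTopII] Cor. 3.3 (iii)(c): a set `R` of REMOVED CUSPS of `U` whose inertia groups normally generate
  (after closure) the kernel of `Π^tp_U ↠ Π^tp_X`, each removed cusp lying over a NON-cuspidal closed point of `X` -/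
  kernel_eq : ∃ R : Set U.Pt, (∀ x ∈ R, U.IsCusp x) ∧
    (K.refHom X U eX eU).ker =
      (Subgroup.normalClosure (⋃ x ∈ R, (U.inertia x : Set U.PiTemp))).topologicalClosure ∧
    ∀ x ∈ R, ∃ y : X.Pt, ¬ X.IsCusp y ∧
      ∃ γ : ConjAct X.PiTemp, (U.decomp x).map (K.refHom X U eX eU) = γ • X.decomp y
  /-- (R2-TF) ELLIPTIC OF LEVEL `N`, print-faithful record: an extension `E` identified with `Π̂_X` (matching `Δ̂_X`),
  a record `C : AbsTopII.EllipticCuspidalizationTF E` with `C.N = N`, and `Π̂_U ≃ C.cuspUX.arith` making the completion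
  square commute -/
  elliptic : ∃ (E : FundamentalExtension.{0}) (iX : X.PiHat ≃ₜ* E.arith)
      (C : Literature.AnabelianGeometry.AbsoluteAnabelian.AbsTopII.EllipticCuspidalizationTF E)
      (iU : U.PiHat ≃ₜ* C.cuspUX.arith),
    C.N = (N : ℕ) ∧ (∀ z : X.PiHat, iX z ∈ E.geom ↔ z ∈ X.DeltaHat) ∧
      ∀ y : U.PiTemp, C.proj.arith (iU (U.toHat y)) = iX (X.toHat (K.refHom X U eX eU y))

variable {K X U eX eU}

/-- **Bridge (finding T1g11-F1):** the frozen-currency predicate implies the print-faithful one — map the (R2)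
record through `AbsTopII.EllipticCuspidalization.toTF` (unique roots ⇒ no non-trivial torsion; all other fields
copied, so `N`, `cuspUX`, `proj` are unchanged). [claim: Mochizuki2012, status: disputed] (IUTchII §1 Prop 1.6 (ii), kurims p.31) -/
theorem RefIsElliptic.toTF (h : K.RefIsElliptic X U eX eU) : K.RefIsEllipticTF X U eX eU where
  deltaTemp_eq := h.deltaTemp_eq
  K_eq := h.K_eq
  continuous_projRef := h.continuous_projRef
  aug_comp := h.aug_comp
  kernel_eq := h.kernel_eq
  elliptic := by
    obtain ⟨E, iX, C, iU, hN, hgeom, hsq⟩ := h.elliptic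
    exact ⟨E, iX, C.toTF, iU, hN, hgeom, hsq⟩

/-- **The label `N` is load-bearing under the TF predicate**: a print-faithful record of level `N` exists.
[claim: Mochizuki2012, status: disputed] (IUTchII §1 Prop 1.6 (ii), kurims p.31) -/
theorem RefIsEllipticTF.exists_level (h : K.RefIsEllipticTF X U eX eU) :
    ∃ (E : FundamentalExtension.{0})
      (C : Literature.AnabelianGeometry.AbsoluteAnabelian.AbsTopII.EllipticCuspidalizationTF E), C.N = (N : ℕ) := by
  obtain ⟨E, -, C, -, hN, -, -⟩ := h.elliptic
  exact ⟨E, C, hN⟩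

end Ref

end EllipticCuspidalization

/-! ## Prop. 1.6 (ii): the GENUINE output structures over the TF predicate -/

/-- **IUTchII:Prop1.6(ii), GENUINE OUTPUT in the print-faithful currency (finding T1g11-F1).** The frozen output
`EllipticCuspidalization S N P` extended, decl-for-decl as abc-iut-w5-d030's `Genuine`, by the identification
`eU : Π^tp_U ≃ₜ* PiURef` and the TF successor predicate `RefIsEllipticTF X U eX eU` — "when `Π = Π^tp_{X̲̲_k}`, the
surjection `Π_{U_N}(Π) ↠ Π` may be naturally identified with … “elliptic cuspidalization” …".  A structure over the
tree's interfaces; never asserted to be inhabited. [claim: Mochizuki2012, status: disputed] (IUTchII §1 Prop 1.6 (ii), kurims p.31) -/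
structure EllipticCuspidalization.GenuineTF (S : ThetaSetting.{u}) (N : ℕ+) (P : TopGroup.{u})
    {p : ℕ} [Fact p.Prime] (X U : TemperedCurve p) (eX : X.PiTemp ≃ₜ* S.PiX)
    extends EllipticCuspidalization S N P where
  /-- the reference side `Π^tp_{U_N}` IS the tempered fundamental group of the curve `U` (playing `U_X`) -/
  eU : U.PiTemp ≃ₜ* toEllipticCuspidalization.PiURef
  /-- the reference surjection IS the elliptic cuspidalisation of level `N` (TF successor predicate) -/
  refIsEllipticTF : toEllipticCuspidalization.RefIsEllipticTF X U eX eU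

namespace EllipticCuspidalization

variable {S : ThetaSetting.{u}} {N : ℕ+} {P P' : TopGroup.{u}} {p : ℕ} [Fact p.Prime] {X U : TemperedCurve p}
  {eX : X.PiTemp ≃ₜ* S.PiX}

/-- **Bridge (finding T1g11-F1):** a genuine output in the frozen currency is one in the print-faithful currency
(same output, same `eU`). [claim: Mochizuki2012, status: disputed] (IUTchII §1 Prop 1.6 (ii), kurims p.31) -/
def Genuine.toTF (G : EllipticCuspidalization.Genuine S N P X U eX) :
    EllipticCuspidalization.GenuineTF S N P X U eX where
  toEllipticCuspidalization := G.toEllipticCuspidalization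
  eU := G.eU
  refIsEllipticTF := G.refIsElliptic.toTF

/-- `Genuine.toTF` keeps the underlying frozen output. [claim: Mochizuki2012, status: disputed] (IUTchII §1 Prop 1.6 (ii), kurims p.31) -/
theorem Genuine.toTF_toEllipticCuspidalization (G : EllipticCuspidalization.Genuine S N P X U eX) :
    G.toTF.toEllipticCuspidalization = G.toEllipticCuspidalization := rfl

/-- **Functoriality** of the TF genuine output along `P ≃ₜ* P'` ("functorial group-theoretic algorithm"): transport
the underlying output (`EllipticCuspidalization.transport`) and keep `eU` and the predicate, whose reference side
does not move — as abc-iut-w5-d030's `Genuine.transport`.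
[claim: Mochizuki2012, status: disputed] (IUTchII §1 Prop 1.6 (ii), kurims p.31) -/
noncomputable def GenuineTF.transport (G : EllipticCuspidalization.GenuineTF S N P X U eX) (f : P ≃ₜ* P') :
    EllipticCuspidalization.GenuineTF S N P' X U eX where
  toEllipticCuspidalization := G.toEllipticCuspidalization.transport f
  eU := G.eU
  refIsEllipticTF :=
    { deltaTemp_eq := G.refIsEllipticTF.deltaTemp_eq
      K_eq := G.refIsEllipticTF.K_eq
      continuous_projRef := G.refIsEllipticTF.continuous_projRef
      aug_comp := G.refIsEllipticTF.aug_comp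
      kernel_eq := G.refIsEllipticTF.kernel_eq
      elliptic := G.refIsEllipticTF.elliptic }

/-- The transport does not move the reference side. [claim: Mochizuki2012, status: disputed] (IUTchII §1 Prop 1.6 (ii), kurims p.31) -/
theorem GenuineTF.transport_PiURef (G : EllipticCuspidalization.GenuineTF S N P X U eX) (f : P ≃ₜ* P') :
    (G.transport f).PiURef = G.PiURef := rfl

end EllipticCuspidalization

/-! ## Prop. 1.6 (i): the core reference clause over the TF record -/

namespace CoreData

section Ref

variable {S : ThetaSetting.{u}} {P : TopGroup.{u}} {p : ℕ} [Fact p.Prime]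
  (Cd : CoreData S P) (X C : TemperedCurve p) (eX : X.PiTemp ≃ₜ* S.PiX) (eC : C.PiTemp ≃ₜ* Cd.PiCRef)

/-- **THE SUCCESSOR PREDICATE of IUTchII:Prop1.6(i) in the print-faithful currency (finding T1g11-F1).**
abc-iut-w5-d030's `RefIsCore` with (R0) and (R1) (continuous open embedding of finite index over the augmentations —
the finite étale covering `X̲̲_k → C_k`, [AbsTopII] Rmk. 3.3.3's "tempered version") VERBATIM, and (R2-core-TF): the
profinite completion of `Π^tp_X ↪ Π^tp_C` IS the `k'`-core `Π' ↪ Π_C` of a PRINT-FAITHFUL [AbsTopII] Cor. 3.3 record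
`AbsTopII.EllipticCuspidalizationTF` over an extension identified with `Π̂_X` (matching `Δ̂_X`).  A `Prop`; never
asserted; to be inhabited at genuine models and consumed BY NAME. [cite: MochizukiAbsTopII2013, Cor 3.3 (i) p.68]
[claim: Mochizuki2012, status: disputed] (IUTchII §1 Prop 1.6 (i), kurims p.31) -/
structure RefIsCoreTF : Prop where
  /-- "`Π = Π^tp_{X̲̲_k}`": `eX` carries `Δ^tp_X` onto the setting's `Δ^tp_{X̲̲_k} = Ker(S.aug)` -/
  deltaTemp_eq : X.DeltaTemp.map eX.toMulEquiv.toMonoidHom = S.DeltaX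
  /-- `X̲̲_k` and its `k`-core `C_k` are curves over the same field `k` -/
  K_eq : C.K = X.K
  /-- the reference inclusion is continuous … -/
  continuous_inclRef : Continuous Cd.inclRef
  /-- … an open embedding … -/
  isOpenEmbedding_refIncl : IsOpenEmbedding (Cd.refIncl X C eX eC)
  /-- … of FINITE index … -/
  finiteIndex_range : (Cd.refIncl X C eX eC).range.FiniteIndex
  /-- … and lies over the augmentations to `G_k ≤ G_{ℚ_p}` -/
  aug_comp : ∀ x : X.PiTemp, C.aug (Cd.refIncl X C eX eC x) = X.aug x
  /-- (R2-core-TF) THE CORE via a print-faithful L4 output: the profinite completion of `Π^tp_X ↪ Π^tp_C` IS the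
  `k'`-core `Π' ↪ Π_C` of an `AbsTopII.EllipticCuspidalizationTF` record over an extension identified with `Π̂_X`
  (matching `Δ̂_X`) -/
  core : ∃ (E : FundamentalExtension.{0}) (iX : X.PiHat ≃ₜ* E.arith)
      (R : Literature.AnabelianGeometry.AbsoluteAnabelian.AbsTopII.EllipticCuspidalizationTF E)
      (iC : C.PiHat ≃ₜ* R.core.arith),
    (∀ z : X.PiHat, iX z ∈ E.geom ↔ z ∈ X.DeltaHat) ∧
      ∀ x : X.PiTemp, R.toCore.arith (iX (X.toHat x)) = iC (C.toHat (Cd.refIncl X C eX eC x))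

variable {Cd X C eX eC}

/-- **Bridge (finding T1g11-F1):** the frozen-currency core predicate implies the print-faithful one (map the record
through `AbsTopII.EllipticCuspidalization.toTF`; `core`/`toCore` are copied).
[claim: Mochizuki2012, status: disputed] (IUTchII §1 Prop 1.6 (i), kurims p.31) -/
theorem RefIsCore.toTF (h : Cd.RefIsCore X C eX eC) : Cd.RefIsCoreTF X C eX eC where
  deltaTemp_eq := h.deltaTemp_eq
  K_eq := h.K_eq
  continuous_inclRef := h.continuous_inclRef
  isOpenEmbedding_refIncl := h.isOpenEmbedding_refIncl
  finiteIndex_range := h.finiteIndex_range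
  aug_comp := h.aug_comp
  core := by
    obtain ⟨E, iX, R, iC, hgeom, hsq⟩ := h.core
    exact ⟨E, iX, R.toTF, iC, hgeom, hsq⟩

/-- Under the TF predicate a print-faithful core record at `Π̂_X` exists, with the completion square.
[claim: Mochizuki2012, status: disputed] (IUTchII §1 Prop 1.6 (i), kurims p.31) -/
theorem RefIsCoreTF.exists_core_record (h : Cd.RefIsCoreTF X C eX eC) :
    ∃ (E : FundamentalExtension.{0}) (iX : X.PiHat ≃ₜ* E.arith)
      (R : Literature.AnabelianGeometry.AbsoluteAnabelian.AbsTopII.EllipticCuspidalizationTF E)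
      (iC : C.PiHat ≃ₜ* R.core.arith),
      ∀ x : X.PiTemp, R.toCore.arith (iX (X.toHat x)) = iC (C.toHat (Cd.refIncl X C eX eC x)) := by
  obtain ⟨E, iX, R, iC, -, hsq⟩ := h.core
  exact ⟨E, iX, R, iC, hsq⟩

end Ref

end CoreData

/-- **IUTchII:Prop1.6(i), GENUINE OUTPUT in the print-faithful currency (finding T1g11-F1)** ("Cores", kurims p. 31):
the frozen output `CoreData S P` extended, decl-for-decl as abc-iut-w5-d030's `CoreData.Genuine`, by the identification
`eC : Π^tp_C ≃ₜ* PiCRef` and the TF successor predicate `RefIsCoreTF X C eX eC`.  A structure over the tree's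
interfaces; never asserted to be inhabited. [claim: Mochizuki2012, status: disputed] (IUTchII §1 Prop 1.6 (i), kurims p.31) -/
structure CoreData.GenuineTF (S : ThetaSetting.{u}) (P : TopGroup.{u}) {p : ℕ} [Fact p.Prime] (X C : TemperedCurve p)
    (eX : X.PiTemp ≃ₜ* S.PiX) extends CoreData S P where
  /-- the reference side `Π^tp_{C_k}` IS the tempered fundamental group of the curve `C` (the `k`-core) -/
  eC : C.PiTemp ≃ₜ* toCoreData.PiCRef
  /-- the reference inclusion IS `Π^tp_{X̲̲_k} ⊆ Π^tp_{C_k}` (TF successor predicate) -/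
  refIsCoreTF : toCoreData.RefIsCoreTF X C eX eC

namespace CoreData

variable {S : ThetaSetting.{u}} {P : TopGroup.{u}} {p : ℕ} [Fact p.Prime] {X C : TemperedCurve p}
  {eX : X.PiTemp ≃ₜ* S.PiX}

/-- **Bridge (finding T1g11-F1):** a genuine core output in the frozen currency is one in the print-faithful currency.
[claim: Mochizuki2012, status: disputed] (IUTchII §1 Prop 1.6 (i), kurims p.31) -/
def Genuine.toTF (G : CoreData.Genuine S P X C eX) : CoreData.GenuineTF S P X C eX where
  toCoreData := G.toCoreData
  eC := G.eC
  refIsCoreTF := G.refIsCore.toTF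

/-- `CoreData.Genuine.toTF` keeps the underlying frozen output. [claim: Mochizuki2012, status: disputed] (IUTchII §1 Prop 1.6 (i), kurims p.31) -/
theorem Genuine.toTF_toCoreData (G : CoreData.Genuine S P X C eX) : G.toTF.toCoreData = G.toCoreData := rfl

end CoreData

end Literature.IUT.HodgeArakelov
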